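import Literature.AlgebraicGeometry.Motives.MumfordTateInvariantsSimilitude
import HarnessLib

/-!
# `Ξ = q' ⊗ q` is a Hodge tensor; `MT(ℚ) ⊆ GSp(Q)` (Mumford–Tate invariants, step 19)

Continuation of `MumfordTateInvariantsSimilitude.lean` (notation from there): for a polarization
`Q` of `H` (pure weight `n`, `V` finite-dimensional),

* `Polarization.xiTensor_mem_hodgeClasses` — the weight-`0` tensor `Ξ = q' ⊗ q ∈ T^{2,2}` is a
  Hodge class of type `(0,0)`. In an `h`-orthonormal graded basis `e` of `V_ℂ` the coordinates of
  `q_ℂ` in `e^∨ ⊗ e^∨` are `Q_ℂ(e σ, e τ)` (zero unless `deg σ + deg τ = n`, first Hodge–Riemann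
  relation) and those of `q'_ℂ` in `e ⊗ e` are `Q^∨_ℂ(e^∨ σ, e^∨ τ)` (zero unless
  `deg σ + deg τ = n`, `Polarization.dualFormC_dualBasis_dualBasis`); so `Ξ_ℂ` lies in the span of
  the tensor basis vectors of total degree `0` (`mem_hodgeClasses_of_mem_span_degree_zero`).
* `Polarization.exists_similitude_of_mem_mumfordTateGroup` — **every `g ∈ MT(H)(ℚ)` is a
  similitude of `Q`**: `Q(g v, g w) = ν Q(v, w)`, `ν ≠ 0` (Deligne, LNM 900, I, proof of 3.6:
  `MT ⊆ GSp(V, Q)`; Green–Griffiths–Kerr (I.B.6)), from `g · Ξ = Ξ`;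
* `Polarization.tensorSpaceAct_mem_orthogonal_of_stable` — hence `g` is a similitude of the
  induced form `Q_T` on `T^{a,b}` and the `Q_T`-orthogonal of an `MT(ℚ)`-stable subspace is
  `MT(ℚ)`-stable (GGK (I.B.6): "`W^⊥` is again `M`-stable").

## References

* P. Deligne, *Hodge cycles on abelian varieties*, LNM 900 (1982), I §3, Prop. 3.4, 3.6.
* M. Green, P. Griffiths, M. Kerr, *Mumford–Tate groups and domains* (2012), (I.B.6).
-/

noncomputable section

open scoped TensorProduct
open PiTensorProduct

namespace Literature.AlgebraicGeometry.Motives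

namespace HodgeStructure

universe u

variable {V : Type u} [AddCommGroup V] [Module ℚ V] [Module.Finite ℚ V] {n : ℤ}
  {H : HodgeStructure V n}

/-! ### Coordinates on `V_ℂ` and `(V_ℂ)^∨` relative to a rational basis -/

omit [Module.Finite ℚ V] in
/-- A functional on `V_ℂ` in the complexified dual basis: `α = Σᵢ α(1 ⊗ bᵢ) (b^i)_ℂ`. [folklore] -/
theorem dual_eq_sum_apply_smul_coord_baseChange {ι : Type*} [Fintype ι] [DecidableEq ι]
    (b : Module.Basis ι ℚ V) (α : Module.Dual ℂ (ℂ ⊗[ℚ] V)) :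
    α = ∑ i, α ((1 : ℂ) ⊗ₜ[ℚ] b i) • Module.Dual.baseChange ℂ (b.coord i) := by
  refine (Algebra.TensorProduct.basis ℂ b).ext fun j => ?_
  simp only [Algebra.TensorProduct.basis_apply, LinearMap.coe_sum, Finset.sum_apply,
    LinearMap.smul_apply, Module.Dual.baseChange_apply_tmul, Module.Basis.coord_apply,
    Module.Basis.repr_self, smul_eq_mul]
  rw [Finset.sum_eq_single j]
  · simp
  · intro i _ hij
    rw [Finsupp.single_eq_of_ne hij]
    simp
  · intro h
    exact absurd (Finset.mem_univ j) h

omit [Module.Finite ℚ V] in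
/-- A vector of `V_ℂ` in the complexified basis: `z = Σₖ (b^k)_ℂ(z) (1 ⊗ bₖ)`. [folklore] -/
theorem eq_sum_coord_baseChange_smul_tmul {ι : Type*} [Fintype ι] [DecidableEq ι]
    (b : Module.Basis ι ℚ V) (z : ℂ ⊗[ℚ] V) :
    z = ∑ k, Module.Dual.baseChange ℂ (b.coord k) z • ((1 : ℂ) ⊗ₜ[ℚ] b k) := by
  suffices h : (LinearMap.id : (ℂ ⊗[ℚ] V) →ₗ[ℂ] ℂ ⊗[ℚ] V) =
      ∑ k, (Module.Dual.baseChange ℂ (b.coord k)).smulRight ((1 : ℂ) ⊗ₜ[ℚ] b k) by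
    simpa using LinearMap.congr_fun h z
  refine (Algebra.TensorProduct.basis ℂ b).ext fun j => ?_
  simp only [Algebra.TensorProduct.basis_apply, LinearMap.id_apply, LinearMap.coe_sum,
    Finset.sum_apply, LinearMap.smulRight_apply, Module.Dual.baseChange_apply_tmul,
    Module.Basis.coord_apply, Module.Basis.repr_self]
  rw [Finset.sum_eq_single j]
  · simp
  · intro i _ hij
    rw [Finsupp.single_eq_of_ne hij]
    simp
  · intro h
    exact absurd (Finset.mem_univ j) h

omit [Module.Finite ℚ V] in
/-- Pure tensors of spans: `x ∈ span (f '' A)`, `y ∈ span (g '' B)` imply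
`x ⊗ y ∈ span {f a ⊗ g b | a ∈ A, b ∈ B}`. [folklore] -/
theorem tmul_mem_span_image_prod {K : Type*} [Field K] {M N : Type*} [AddCommGroup M] [Module K M]
    [AddCommGroup N] [Module K N] {α β : Type*} (f : α → M) (g : β → N) (A : Set α) (B : Set β)
    {x : M} {y : N} (hx : x ∈ Submodule.span K (f '' A)) (hy : y ∈ Submodule.span K (g '' B)) :
    x ⊗ₜ[K] y ∈ Submodule.span K ((fun p : α × β => f p.1 ⊗ₜ[K] g p.2) '' A ×ˢ B) := by
  induction hx using Submodule.span_induction with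
  | mem x hx' =>
    obtain ⟨a, ha, rfl⟩ := hx'
    induction hy using Submodule.span_induction with
    | mem y hy' =>
      obtain ⟨b', hb, rfl⟩ := hy'
      exact Submodule.subset_span ⟨(a, b'), ⟨ha, hb⟩, rfl⟩
    | zero => simp
    | add y z _ _ hy hz =>
      rw [TensorProduct.tmul_add]
      exact Submodule.add_mem _ hy hz
    | smul c y _ hy =>
      rw [TensorProduct.tmul_smul]
      exact Submodule.smul_mem _ c hy
  | zero => simp
  | add x z _ _ hx hz =>
    rw [TensorProduct.add_tmul]
    exact Submodule.add_mem _ hx hz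
  | smul c x _ hx =>
    rw [← TensorProduct.smul_tmul']
    exact Submodule.smul_mem _ c hx

omit [Module.Finite ℚ V] in
/-- A double sum `Σ_σ Σ_τ c σ τ • T σ τ` whose non-zero coefficients only occur on `P` lies in
`span (T '' P)`. [folklore] -/
theorem sum_sum_smul_mem_span {K : Type*} [Field K] {M : Type*} [AddCommGroup M] [Module K M]
    {S : Type*} [Fintype S] (c : S → S → K) (T : S × S → M) (P : Set (S × S))
    (h : ∀ σ τ, c σ τ ≠ 0 → (σ, τ) ∈ P) :
    ∑ σ, ∑ τ, c σ τ • T (σ, τ) ∈ Submodule.span K (T '' P) := by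
  refine Submodule.sum_mem _ fun σ _ => Submodule.sum_mem _ fun τ _ => ?_
  by_cases hc : c σ τ = 0
  · simp [hc]
  · exact Submodule.smul_mem _ _ (Submodule.subset_span ⟨(σ, τ), h σ τ hc, rfl⟩)

/-! ### The complexified tensors `q'_ℂ`, `q_ℂ` in a graded orthonormal basis -/

section Graded

variable (Q : Polarization H) {S : Type u} [Fintype S] [DecidableEq S] {deg : S → ℤ}
  (e : Module.Basis S ℂ (ℂ ⊗[ℚ] V))
  (hon : ∀ σ τ, Q.form.baseChange ℂ (e σ) (conj (e τ)) =
    if σ = τ then (hodgeSign n (deg σ))⁻¹ else 0)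
  (he : ∀ σ, e σ ∈ H.piece (deg σ) (n - deg σ))
include hon he

omit hon he in
/-- **`q'_ℂ = Σ_{σ,τ} Q^∨_ℂ(e^∨ σ, e^∨ τ) · e σ ⊗ e τ`** (the tensor of the inverse form is
basis independent). [folklore] -/
theorem Polarization.piTensorToBaseChange_dualFormTensor :
    piTensorToBaseChange ℂ V 2 Q.dualFormTensor =
      ∑ σ, ∑ τ, (dualFormBaseChange V Q.dualForm (e.dualBasis σ) (e.dualBasis τ)) •
        tprod ℂ ![e σ, e τ] := by
  classical
  set b := Module.finBasis ℚ V with hb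
  obtain ⟨r, hr⟩ : ∃ r : Fin (Module.finrank ℚ V) → S → ℂ,
      ∀ i σ, r i σ = e.repr ((1 : ℂ) ⊗ₜ[ℚ] b i) σ := ⟨_, fun _ _ => rfl⟩
  have hx : ∀ i j, (tprod ℂ ![(1 : ℂ) ⊗ₜ[ℚ] b i, (1 : ℂ) ⊗ₜ[ℚ] b j] : ⨂[ℂ]^2 (ℂ ⊗[ℚ] V)) =
      ∑ p : S × S, (r i p.1 * r j p.2) • tprod ℂ ![e p.1, e p.2] := by
    intro i j
    conv_lhs => rw [← e.sum_repr ((1 : ℂ) ⊗ₜ[ℚ] b i), ← e.sum_repr ((1 : ℂ) ⊗ₜ[ℚ] b j)]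
    rw [tprod_two_sum_smul_sum_smul, ← Fintype.sum_prod_type']
    simp_rw [hr]
  have hC : ∀ p : S × S, ∑ q : Fin (Module.finrank ℚ V) × Fin (Module.finrank ℚ V),
      ((Q.dualForm (b.coord q.1) (b.coord q.2) : ℚ) : ℂ) * (r q.1 p.1 * r q.2 p.2) =
      dualFormBaseChange V Q.dualForm (e.dualBasis p.1) (e.dualBasis p.2) := by
    intro p
    conv_rhs => rw [dual_eq_sum_apply_smul_coord_baseChange b (e.dualBasis p.1),
      dual_eq_sum_apply_smul_coord_baseChange b (e.dualBasis p.2), bilin_apply_sum_smul_sum_smul,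
      ← Fintype.sum_prod_type']
    refine Finset.sum_congr rfl fun q _ => ?_
    rw [dualFormBaseChange_baseChange, Module.Basis.dualBasis_apply, Module.Basis.dualBasis_apply,
      ← hr, ← hr]
    ring
  rw [Polarization.dualFormTensor, ← hb, map_sum]
  simp_rw [map_sum, map_smul, piTensorToBaseChange_tprod]
  have hvec : ∀ i j, (fun k => (1 : ℂ) ⊗ₜ[ℚ] (![b i, b j] : Fin 2 → V) k) =
      ![(1 : ℂ) ⊗ₜ[ℚ] b i, (1 : ℂ) ⊗ₜ[ℚ] b j] := fun i j => by
    funext k; fin_cases k <;> rfl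
  simp_rw [hvec, hx, ← Fintype.sum_prod_type', ← hC]
  simp_rw [← algebraMap_smul ℂ (Q.dualForm _ _), Finset.smul_sum, smul_smul, eq_ratCast]
  rw [Finset.sum_comm]
  simp_rw [Finset.sum_smul]

/-- `q'_ℂ ∈ span {e σ ⊗ e τ | deg σ + deg τ = n}`. [folklore] -/
theorem Polarization.piTensorToBaseChange_dualFormTensor_mem_span :
    piTensorToBaseChange ℂ V 2 Q.dualFormTensor ∈ Submodule.span ℂ
      ((fun p : S × S => tprod ℂ ![e p.1, e p.2]) '' {p | deg p.1 + deg p.2 = n}) := by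
  rw [Q.piTensorToBaseChange_dualFormTensor e]
  refine sum_sum_smul_mem_span _ (fun p : S × S => tprod ℂ ![e p.1, e p.2]) _ fun σ τ hc => ?_
  by_contra hst
  exact hc (Q.dualFormC_dualBasis_dualBasis e hon he hst)

omit hon he in
/-- **`q_ℂ = Σ_{σ,τ} Q_ℂ(e σ, e τ) · e^∨ σ ⊗ e^∨ τ`** (the tensor of `Q` is basis independent).
[folklore] -/
theorem Polarization.piTensorDualToBaseChange_formTensor :
    piTensorDualToBaseChange ℂ V 2 Q.formTensor =
      ∑ σ, ∑ τ, (Q.form.baseChange ℂ (e σ) (e τ)) • tprod ℂ ![e.dualBasis σ, e.dualBasis τ] := by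
  classical
  set b := Module.finBasis ℚ V with hb
  obtain ⟨s, hs⟩ : ∃ s : Fin (Module.finrank ℚ V) → S → ℂ,
      ∀ k σ, s k σ = Module.Dual.baseChange ℂ (b.coord k) (e σ) := ⟨_, fun _ _ => rfl⟩
  have hdual : ∀ k, Module.Dual.baseChange ℂ (b.coord k) = ∑ σ, s k σ • e.dualBasis σ := by
    intro k
    conv_lhs => rw [← e.sum_dual_apply_smul_coord (Module.Dual.baseChange ℂ (b.coord k))]
    simp_rw [hs, Module.Basis.coe_dualBasis]
  have hx : ∀ k l, (tprod ℂ ![Module.Dual.baseChange ℂ (b.coord k), Module.Dual.baseChange ℂ (b.coord l)] :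
      ⨂[ℂ]^2 (Module.Dual ℂ (ℂ ⊗[ℚ] V))) =
      ∑ p : S × S, (s k p.1 * s l p.2) • tprod ℂ ![e.dualBasis p.1, e.dualBasis p.2] := by
    intro k l
    rw [hdual k, hdual l, tprod_two_sum_smul_sum_smul, ← Fintype.sum_prod_type']
  have hD : ∀ p : S × S, ∑ q : Fin (Module.finrank ℚ V) × Fin (Module.finrank ℚ V),
      ((Q.form (b q.1) (b q.2) : ℚ) : ℂ) * (s q.1 p.1 * s q.2 p.2) =
      Q.form.baseChange ℂ (e p.1) (e p.2) := by
    intro p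
    conv_rhs => rw [eq_sum_coord_baseChange_smul_tmul b (e p.1),
      eq_sum_coord_baseChange_smul_tmul b (e p.2), bilin_apply_sum_smul_sum_smul,
      ← Fintype.sum_prod_type']
    refine Finset.sum_congr rfl fun q _ => ?_
    rw [LinearMap.BilinForm.baseChange_tmul, mul_one, Rat.smul_one_eq_cast, ← hs, ← hs]
    ring
  rw [Polarization.formTensor, ← hb, map_sum]
  simp_rw [map_sum, map_smul, piTensorDualToBaseChange_tprod]
  have hvec : ∀ k l, (fun m => Module.Dual.baseChange ℂ ((![b.coord k, b.coord l] :
      Fin 2 → Module.Dual ℚ V) m)) =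
      ![Module.Dual.baseChange ℂ (b.coord k), Module.Dual.baseChange ℂ (b.coord l)] := fun k l => by
    funext m; fin_cases m <;> rfl
  simp_rw [hvec, hx, ← Fintype.sum_prod_type', ← hD]
  simp_rw [← algebraMap_smul ℂ (Q.form _ _), Finset.smul_sum, smul_smul, eq_ratCast]
  rw [Finset.sum_comm]
  simp_rw [Finset.sum_smul]

omit hon in
/-- `q_ℂ ∈ span {e^∨ σ ⊗ e^∨ τ | deg σ + deg τ = n}`. [folklore] -/
theorem Polarization.piTensorDualToBaseChange_formTensor_mem_span :
    piTensorDualToBaseChange ℂ V 2 Q.formTensor ∈ Submodule.span ℂ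
      ((fun p : S × S => tprod ℂ ![e.dualBasis p.1, e.dualBasis p.2]) ''
        {p | deg p.1 + deg p.2 = n}) := by
  rw [Q.piTensorDualToBaseChange_formTensor e]
  refine sum_sum_smul_mem_span _ (fun p : S × S => tprod ℂ ![e.dualBasis p.1, e.dualBasis p.2]) _
    fun σ τ hc => ?_
  by_contra hst
  exact hc (Q.form_piece_piece hst (he σ) (he τ))

end Graded

/-! ### `Ξ` is a Hodge class -/

omit [Module.Finite ℚ V] in
/-- The comparison map on a tensor product of arbitrary elements. [folklore] -/
theorem tensorSpaceToBaseChange_tmul {a b : ℕ} (x : ⨂[ℚ]^a V) (y : ⨂[ℚ]^b (Module.Dual ℚ V)) :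
    tensorSpaceToBaseChange ℂ V a b (x ⊗ₜ[ℚ] y) =
      piTensorToBaseChange ℂ V a x ⊗ₜ[ℂ] piTensorDualToBaseChange ℂ V b y := by
  simp [tensorSpaceToBaseChange]

variable [HodgeTensorFacts.{u, u}]

/-- **`Ξ = q' ⊗ q ∈ T^{2,2}` is a Hodge class of type `(0,0)`** (the tensor `Q^∨ ⊗ Q` of the
morphisms of Hodge structures `Q : V ⊗ V → ℚ(-n)`, `Q^∨ : V^∨ ⊗ V^∨ → ℚ(n)`; Deligne, Hodge II,
2.1.15). [folklore] -/
theorem Polarization.xiTensor_mem_hodgeClasses (Q : Polarization H) :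
    Q.xiTensor ∈ (H.tensorSpace 2 2).hodgeClasses 0 := by
  obtain ⟨S, _, _, deg, e, hF, -, he, hon⟩ := Q.exists_orthonormal_graded_basis
  apply mem_hodgeClasses_of_mem_span_degree_zero H e hF
  rw [Polarization.xiTensor, tensorSpaceToBaseChange_tmul]
  have h := tmul_mem_span_image_prod _ _ _ _
    (Q.piTensorToBaseChange_dualFormTensor_mem_span e hon he)
    (Q.piTensorDualToBaseChange_formTensor_mem_span e he)
  refine Submodule.span_mono ?_ h
  rintro _ ⟨⟨⟨σ, τ⟩, ⟨σ', τ'⟩⟩, ⟨hst, hst'⟩, rfl⟩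
  simp only [Set.mem_setOf_eq] at hst hst'
  refine ⟨(![σ, τ], ![σ', τ']), ?_, ?_⟩
  · simp only [Set.mem_setOf_eq, tensorDegree_apply, Fin.sum_univ_two, Matrix.cons_val_zero,
      Matrix.cons_val_one]
    omega
  · rw [hodgeTensorBasis_apply]
    congr 2
    · funext k; fin_cases k <;> rfl
    · funext l; fin_cases l <;> rfl

/-! ### `MT(ℚ) ⊆ GSp(Q)`: similitudes -/

/-- For `g ∈ MT(H)(ℚ)`: `Q^∨(φ ∘ g, ψ ∘ g) · Q(g⁻¹ v, g⁻¹ w) = Q^∨(φ, ψ) · Q(v, w)` (evaluate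
`g · Ξ = Ξ`). [folklore] -/
theorem Polarization.dualForm_mul_form_eq_of_mem_mumfordTateGroup (Q : Polarization H)
    {g : V ≃ₗ[ℚ] V} (hg : g ∈ H.mumfordTateGroup) (φ ψ : Module.Dual ℚ V) (v w : V) :
    Q.dualForm (φ ∘ₗ (g : V →ₗ[ℚ] V)) (ψ ∘ₗ (g : V →ₗ[ℚ] V)) * Q.form (g.symm v) (g.symm w) =
      Q.dualForm φ ψ * Q.form v w := by
  rw [← Q.eval_tensorSpaceAct_xiTensor, (H.mem_mumfordTateGroup_iff g).1 hg 2 2 (by ring) _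
    Q.xiTensor_mem_hodgeClasses, Q.eval_xiTensor]

/-- **`MT(H)(ℚ) ⊆ GSp(V, Q)`: every element of the Mumford–Tate group is a similitude of the
polarization**, `Q(g v, g w) = ν Q(v, w)` with `ν ≠ 0` (Deligne, LNM 900, I, proof of Prop. 3.6;
GGK (I.B.6)). [cite: Deligne1982HodgeCycles, I Prop. 3.6 (proof)] -/
theorem Polarization.exists_similitude_of_mem_mumfordTateGroup (Q : Polarization H)
    {g : V ≃ₗ[ℚ] V} (hg : g ∈ H.mumfordTateGroup) :
    ∃ ν : ℚ, ν ≠ 0 ∧ ∀ v w, Q.form (g v) (g w) = ν * Q.form v w := by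
  by_cases hQ : ∀ v w : V, Q.form v w = 0
  · exact ⟨1, one_ne_zero, fun v w => by rw [hQ, hQ, one_mul]⟩
  simp only [not_forall] at hQ
  obtain ⟨v₀, w₀, h₀⟩ := hQ
  -- `φ₀ = θ v₀`, `ψ₀ = θ w₀` have `Q^∨(φ₀, ψ₀) = Q(v₀, w₀) ≠ 0`
  set φ₀ := Q.toDualEquiv v₀ with hφ₀
  set ψ₀ := Q.toDualEquiv w₀ with hψ₀
  have hd₀ : Q.dualForm φ₀ ψ₀ = Q.form v₀ w₀ := by
    rw [Q.dualForm_apply, hφ₀, hψ₀, LinearEquiv.symm_apply_apply, LinearEquiv.symm_apply_apply]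
  -- the identity for `g⁻¹ ∈ MT`
  have hinv : g⁻¹ ∈ H.mumfordTateGroup := inv_mem hg
  have key : ∀ v w, Q.dualForm (φ₀ ∘ₗ ((g⁻¹ : V ≃ₗ[ℚ] V) : V →ₗ[ℚ] V))
      (ψ₀ ∘ₗ ((g⁻¹ : V ≃ₗ[ℚ] V) : V →ₗ[ℚ] V)) * Q.form (g v) (g w) =
      Q.dualForm φ₀ ψ₀ * Q.form v w := by
    intro v w
    have h := Q.dualForm_mul_form_eq_of_mem_mumfordTateGroup hinv φ₀ ψ₀ v w
    have hs : ∀ x, (g⁻¹ : V ≃ₗ[ℚ] V).symm x = g x := fun x => rfl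
    rwa [hs, hs] at h
  set d := Q.dualForm (φ₀ ∘ₗ ((g⁻¹ : V ≃ₗ[ℚ] V) : V →ₗ[ℚ] V))
    (ψ₀ ∘ₗ ((g⁻¹ : V ≃ₗ[ℚ] V) : V →ₗ[ℚ] V)) with hd
  have hdne : d ≠ 0 := by
    intro hd0
    have h := key v₀ w₀
    rw [hd0, zero_mul, hd₀] at h
    exact h₀ (mul_self_eq_zero.1 h.symm)
  refine ⟨Q.dualForm φ₀ ψ₀ / d, div_ne_zero (hd₀ ▸ h₀) hdne, fun v w => ?_⟩
  have h := key v w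
  field_simp
  linear_combination h

/-- `g ∈ MT(H)(ℚ)` is a similitude of the induced form on every `T^{a,b}`:
`Q_T(g·x, g·y) = c Q_T(x, y)`. [folklore] -/
theorem Polarization.exists_tensorForm_similitude (Q : Polarization H) {g : V ≃ₗ[ℚ] V}
    (hg : g ∈ H.mumfordTateGroup) (a b : ℕ) :
    ∃ c : ℚ, ∀ x y, Q.tensorForm a b (tensorSpaceAct g x) (tensorSpaceAct g y) =
      c * Q.tensorForm a b x y := by
  obtain ⟨ν, hν, hsim⟩ := Q.exists_similitude_of_mem_mumfordTateGroup hg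
  refine ⟨ν ^ a * ν⁻¹ ^ b, fun x y => ?_⟩
  rw [← tensorSpaceActOver_rat]
  exact tensorForm_tensorSpaceActOver Q.form Q.dualForm g hsim (Q.dualForm_comp_symm g hν hsim) x y

omit [HodgeTensorFacts.{u, u}] [Module.Finite ℚ V] in
/-- The inverse action: `(g·)⁻¹ = g⁻¹·` on `T^{a,b}`. [folklore] -/
theorem tensorSpaceAct_symm_apply {a b : ℕ} (g : V ≃ₗ[ℚ] V) (x : hodgeTensorSpace V a b) :
    (tensorSpaceAct g).symm x = tensorSpaceAct g⁻¹ x := by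
  rw [LinearEquiv.symm_apply_eq, ← tensorSpaceAct_mul_apply, mul_inv_cancel, tensorSpaceAct_one]
  rfl

/-- **The `Q_T`-orthogonal of an `MT(ℚ)`-stable subspace of `T^{a,b}` is `MT(ℚ)`-stable**
(GGK (I.B.6)). [cite: GreenGriffithsKerr2012, I.B.6] -/
theorem Polarization.tensorSpaceAct_mem_orthogonal_of_stable (Q : Polarization H) {a b : ℕ}
    (W : Submodule ℚ (hodgeTensorSpace V a b))
    (hW : ∀ g ∈ H.mumfordTateGroup, ∀ w ∈ W, tensorSpaceAct g w ∈ W) {g : V ≃ₗ[ℚ] V}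
    (hg : g ∈ H.mumfordTateGroup) {y : hodgeTensorSpace V a b}
    (hy : y ∈ (Q.tensorForm a b).orthogonal W) :
    tensorSpaceAct g y ∈ (Q.tensorForm a b).orthogonal W := by
  obtain ⟨c, hc⟩ := Q.exists_tensorForm_similitude hg a b
  refine apply_mem_orthogonal_of_similitude (Q.tensorForm a b) (tensorSpaceAct g) hc W
    (fun x hx => ?_) hy
  rw [tensorSpaceAct_symm_apply]
  exact hW _ (inv_mem hg) x hx

end HodgeStructure

end Literature.AlgebraicGeometry.Motives

end
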